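import Mathlib
import Summits.Schanuel.Schanuel.Theses.RigidCore
import Summits.Schanuel.Schanuel.Theses.GaussianStokesSector
import Summits.Schanuel.Schanuel.Theses.ExceptionalSubspaces
import Summits.Schanuel.Schanuel.Theorems.RigidCoreSchanuelOnLogFreeCoreSectorGlue
import Summits.Schanuel.Schanuel.Theorems.RigidCoreSchanuelOnLogFreeCoreSectorExact
import Summits.Schanuel.Schanuel.Theorems.RigidCoreSchanuelOnLogFreeCorePiFreeOfStageZero
import Summits.Schanuel.Schanuel.Theorems.RigidCoreSchanuelOnLogFreeCoreExceptionalSubspacesIntersect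
import Summits.Schanuel.Schanuel.Theorems.RigidCoreSchanuelOnLogFreeCoreAxesReduction

/-!
# Line `sector-split` (route `RigidCore`), skeleton v9: the axes-refined sector split of (R) is exact

Packaging file of line `sector-split` (v6–v9, axes refinement, lead c5) of crux `stmt-Schanuel-0970`
(`Summit.Schanuel.Schanuel.Theses.RigidCore.SchanuelOnLogFreeCore`, (R) = Schanuel's statement for
`ℚ`-linearly independent tuples from the log-free core `C_EA`).  Registered stub
`stub_axesSplitExact` (signature verbatim):

  `(R) ⟺ PiFreeOnAxes ∧ CoreRel`,

where `PiFreeOnAxes` is the π–LW sector ON THE AXES (for `ℚ`-free algebraic `a₁,…,a_d`, each real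
or purely imaginary, `trdeg ℚ(π, e^{a}) ≥ d + 1`) and `CoreRel` is relative Schanuel over the π–LW
field for core tuples free modulo `V₂ = span_ℚ(ℚ̄ ∪ {πi})` (item stmt-Schanuel-9548 restricted to
the core).  All arrows are landed theorems of the line, assembled here by name:
* `(R) ⟹ PiFreeOverLWField ⟹ PiFreeOnAxes`: `KernelTower.piFreeOverLWField_of_schanuelOnLogFreeCore`
  (p109943) and dropping a hypothesis;
* `(R) ⟹ CoreRel`: `stub_coreRel_of_crux` (p138308);
* `⟸`: the axes reduction `stub_piFree_of_piFreeOnAxes` (p140402, wave 1 of this seat) fed with the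
  engine `stub_exceptionalSubspacesIntersect` (p139838), then `stub_sectorGlue` (p137998).
Corollaries: `PiFreeOverLWField ⟺ PiFreeOnAxes` (the residue every route of the summit shares is
"π is transcendental over ℚ(e^a, e^{ib} : a, b real algebraic)"), and the calibration
`PiFreeOnAxes ⟹ e ⊥ π`.  No new definitions; open statements appear only as hypotheses/conjuncts.
-/

noncomputable section

namespace Summit.Schanuel.Schanuel.Theorems.RigidCore

open Summit.Schanuel.Schanuel.Theses

/-- **Registered stub `stub_axesSplitExact` of line `sector-split` (v9)** (signature verbatim):
the axes-refined sector split of (R) is exact — `(R) ⟺ PiFreeOnAxes ∧ CoreRel`. [folklore] -/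
theorem stub_axesSplitExact :
    RigidCore.SchanuelOnLogFreeCore ↔
      ((∀ (d : ℕ) (a : Fin d → ℂ), (∀ i, IsAlgebraic ℚ (a i)) → (∀ i, (a i).im = 0 ∨ (a i).re = 0) →
          LinearIndependent ℚ a →
          ((d + 1 : ℕ) : Cardinal) ≤ Algebra.trdeg ℚ
            ↥(IntermediateField.adjoin ℚ (insert (Real.pi : ℂ) (Set.range (Complex.exp ∘ a))))) ∧
        ∀ (n : ℕ) (x : Fin n → ℂ),
          (∀ i, x i ∈ (sInf {K : IntermediateField ℚ ℂ | (2 * ↑Real.pi * Complex.I : ℂ) ∈ K ∧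
            (∀ w ∈ K, Complex.exp w ∈ K) ∧ ∀ w : ℂ, IsAlgebraic K w → w ∈ K} : IntermediateField ℚ ℂ)) →
          LinearIndependent ℚ ((Submodule.span ℚ ({z : ℂ | IsAlgebraic ℚ z} ∪ {(Real.pi : ℂ) * Complex.I})).mkQ ∘ x) →
          (n : Cardinal) ≤ Algebra.trdeg
            ↥(IntermediateField.adjoin ℚ ({z : ℂ | IsAlgebraic ℚ z} ∪ {(Real.pi : ℂ) * Complex.I} ∪ Complex.exp '' {z : ℂ | IsAlgebraic ℚ z}))
            ↥(IntermediateField.adjoin ↥(IntermediateField.adjoin ℚ ({z : ℂ | IsAlgebraic ℚ z} ∪ {(Real.pi : ℂ) * Complex.I} ∪ Complex.exp '' {z : ℂ | IsAlgebraic ℚ z})) (Set.range x ∪ Set.range (Complex.exp ∘ x)))) := by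
  refine ⟨fun hR => ⟨fun d a halg _ hli => ?_, stub_coreRel_of_crux hR⟩, fun h => ?_⟩
  · exact KernelTower.piFreeOverLWField_of_schanuelOnLogFreeCore hR d a halg hli
  · exact stub_sectorGlue
      (stub_piFree_of_piFreeOnAxes stub_exceptionalSubspacesIntersect h.1) h.2

namespace AxesSplit

/-- **The π–LW residue reduces to the axes**: `PiFreeOverLWField` (item stmt-Schanuel-9545: `π`
is transcendental over the Lindemann–Weierstrass field `ℚ(e^α : α ∈ ℚ̄)`) is EQUIVALENT to its
restriction to `ℚ`-free algebraic tuples whose entries are real or purely imaginary, i.e. to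
"`π` is transcendental over `ℚ(e^a, e^{ib} : a, b ∈ ℚ̄ ∩ ℝ)`". [folklore] -/
theorem piFreeOverLWField_iff_onAxes :
    GaussianStokesSector.PiFreeOverLWField ↔
      ∀ (d : ℕ) (a : Fin d → ℂ), (∀ i, IsAlgebraic ℚ (a i)) → (∀ i, (a i).im = 0 ∨ (a i).re = 0) →
        LinearIndependent ℚ a →
        ((d + 1 : ℕ) : Cardinal) ≤ Algebra.trdeg ℚ
          ↥(IntermediateField.adjoin ℚ (insert (Real.pi : ℂ) (Set.range (Complex.exp ∘ a)))) :=
  ⟨fun hP d a halg _ hli => hP d a halg hli,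
    fun hAx => stub_piFree_of_piFreeOnAxes stub_exceptionalSubspacesIntersect hAx⟩

/-- The same reduction for the sibling route's copy of the residue,
`ExceptionalSubspaces.PiFreeOverLWField` (item stmt-Schanuel-9545, shared verbatim). [folklore] -/
theorem exceptionalSubspaces_piFreeOverLWField_iff_onAxes :
    ExceptionalSubspaces.PiFreeOverLWField ↔
      ∀ (d : ℕ) (a : Fin d → ℂ), (∀ i, IsAlgebraic ℚ (a i)) → (∀ i, (a i).im = 0 ∨ (a i).re = 0) →
        LinearIndependent ℚ a →
        ((d + 1 : ℕ) : Cardinal) ≤ Algebra.trdeg ℚ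
          ↥(IntermediateField.adjoin ℚ (insert (Real.pi : ℂ) (Set.range (Complex.exp ∘ a)))) :=
  piFreeOverLWField_iff_onAxes

/-- **Calibration of residue 1′**: the on-axes π–LW sector already contains `e ⊥ π`
(`ExpOnePiAlgebraicIndependent`, printed open) — its instance `d = 1`, `a = (1)`. [folklore] -/
theorem expOnePi_of_piFreeOnAxes
    (hAx : ∀ (d : ℕ) (a : Fin d → ℂ), (∀ i, IsAlgebraic ℚ (a i)) →
      (∀ i, (a i).im = 0 ∨ (a i).re = 0) → LinearIndependent ℚ a →
      ((d + 1 : ℕ) : Cardinal) ≤ Algebra.trdeg ℚ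
        ↥(IntermediateField.adjoin ℚ (insert (Real.pi : ℂ) (Set.range (Complex.exp ∘ a))))) :
    Literature.NumberTheory.Transcendental.ExpOnePiAlgebraicIndependent :=
  KernelTower.expOnePi_of_piFreeOverLWField (piFreeOverLWField_iff_onAxes.2 hAx)

/-- `α²` real means `α` is real or purely imaginary. [folklore] -/
theorem im_eq_zero_or_re_eq_zero_of_sq_im_eq_zero {α : ℂ} (h : (α ^ 2).im = 0) :
    α.im = 0 ∨ α.re = 0 := by
  have h2 : α.re * α.im = 0 := by
    have : (α ^ 2).im = 2 * (α.re * α.im) := by simp [pow_two, Complex.mul_im]; ring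
    rw [this] at h
    linarith [h]
  rcases mul_eq_zero.1 h2 with h | h
  · exact Or.inr h
  · exact Or.inl h

/-- **Residue 1′ contains the crux `RealAbelianResidue`** (item stmt-Schanuel-9547 of route
ExceptionalSubspaces: `π ⊥ e^α` for every non-zero algebraic `α` with `α²` real-abelian): such `α`
lie on the axes, so this is the `d = 1` layer of `PiFreeOnAxes` (restricted to real-abelian
squares). [folklore] -/
theorem realAbelianResidue_of_piFreeOnAxes
    (hAx : ∀ (d : ℕ) (a : Fin d → ℂ), (∀ i, IsAlgebraic ℚ (a i)) →
      (∀ i, (a i).im = 0 ∨ (a i).re = 0) → LinearIndependent ℚ a →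
      ((d + 1 : ℕ) : Cardinal) ≤ Algebra.trdeg ℚ
        ↥(IntermediateField.adjoin ℚ (insert (Real.pi : ℂ) (Set.range (Complex.exp ∘ a))))) :
    ExceptionalSubspaces.RealAbelianResidue := by
  intro α hα hα0 hab
  have haxis : α.im = 0 ∨ α.re = 0 := im_eq_zero_or_re_eq_zero_of_sq_im_eq_zero hab.1
  have hli : LinearIndependent ℚ (fun _ : Fin 1 => α) :=
    (linearIndependent_unique_iff (v := fun _ : Fin 1 => α)).mpr hα0
  have h1 := hAx 1 (fun _ => α) (fun _ => hα) (fun _ => haxis) hli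
  have hle : IntermediateField.adjoin ℚ
        (insert (Real.pi : ℂ) (Set.range (Complex.exp ∘ fun _ : Fin 1 => α))) ≤
      IntermediateField.adjoin ℚ (Set.range ![(Real.pi : ℂ), Complex.exp α]) := by
    refine IntermediateField.adjoin.mono ℚ _ _ (Set.insert_subset_iff.mpr ⟨⟨0, rfl⟩, ?_⟩)
    rintro _ ⟨j, rfl⟩
    exact ⟨1, rfl⟩
  exact Literature.Barriers.Schanuel.algebraicIndependent_of_le_trdeg_adjoin _
    (h1.trans (trdeg_le_of_injective (IntermediateField.inclusion hle)
      (IntermediateField.inclusion_injective hle)))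

/-- **The crux from residue 1′ and the EXISTING item stmt-Schanuel-9548**
(`RelSchanuelOverPiLWField`). (Conditional: both hypotheses are open.) [folklore] -/
theorem crux_of_piFreeOnAxes_of_relSchanuel
    (hAx : ∀ (d : ℕ) (a : Fin d → ℂ), (∀ i, IsAlgebraic ℚ (a i)) →
      (∀ i, (a i).im = 0 ∨ (a i).re = 0) → LinearIndependent ℚ a →
      ((d + 1 : ℕ) : Cardinal) ≤ Algebra.trdeg ℚ
        ↥(IntermediateField.adjoin ℚ (insert (Real.pi : ℂ) (Set.range (Complex.exp ∘ a)))))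
    (hRel : GaussianStokesSector.RelSchanuelOverPiLWField) : RigidCore.SchanuelOnLogFreeCore := by
  intro n x _ hx
  exact stub_sectorAssembly (piFreeOverLWField_iff_onAxes.2 hAx) hRel n x hx

end AxesSplit

end Summit.Schanuel.Schanuel.Theorems.RigidCore

end
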